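import Summits.Langlands.Langlands.Theorems.SoloInformedPureDominance
import Literature.NumberTheory.GaloisRepresentations.WeilDeligneDominanceRank
import Literature.NumberTheory.GaloisRepresentations.WeilDelignePureFrobSS
import Literature.NumberTheory.Automorphic.VarmaLocalGlobalPrecIProofs
import Literature.Barriers.Langlands.MonodromyNotClosedUnderPadicLimits
import HarnessLib

/-!
# The purity door in Varma's shape: traces + `≺_I` + Galois-side purity ⇒ local–global compatibility (solo seat `solo-Langlands-informed`)

New mathematics relative to the audited statement `Summit.Langlands` (not a reproduction).

`SoloInformedPureDominance` proved: if `rss = (ι WD_v(ρ))^{F-ss}` is PURE and `W` is a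
Frobenius-semisimple representative of `rec_v(π_v)` with `W.ρ = rss.ρ` and
`rk rss.N^i ≤ rk W.N^i` for all `i`, then `LocalGlobalCompatibleAt 𝓡 ι π ρ v`.  Its two
compatibility hypotheses were a hand-made normal form.  This file replaces them by, literally,
the per-place conclusion of the tree's named fact
`Literature.NumberTheory.Automorphic.Varma2024.theorem12_trace_eq_and_precI` (I. Varma, Forum
Math. Sigma 12 (2024) e21, Thms. 1–2): for a Frobenius-semisimple representative `S` of the
automorphic class,

* (traces) `tr (ι WD_v(ρ)).ρ(w) = tr S.ρ(w)` for all `w ∈ W_{K_v}` (Thm. 1, `WD^{ss} ≅ rec^{ss}`),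
* (`≺_I`)  `(ι WD_v(ρ)).PrecI S` (Thm. 2 with Lemma 8.4 (2)),

plus purity of `ι WD_v(ρ)` itself (weight–monodromy for `ρ|_{G_v}`; purity is insensitive to
Frobenius-semisimplification, `IsFrobSemisimplificationOf.isPure_iff`).  The passage is:
Frobenius-semisimplify (`exists_isFrobSemisimplificationOf`); equal traces of Frobenius-
semisimple representations give `e : rss.ρ ≅ S.ρ` (Brauer–Nesbitt–Bourbaki,
`nonempty_equiv_of_isFrobSemisimple_of_trace_eq`); transport `S` along `e⁻¹` to `W` with
`W.ρ = rss.ρ` on the nose (`WeilDeligneRep.transport`); `≺_I` passes to `rss ≺_I W`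
(`precI_iff_left`, `IsEquivalent.precI_iff_right`) and implies rank dominance
`rk rss.N^i ≤ rk W.N^i` (`PrecI.finrank_range_pow_le`, Bellaïche–Chenevier §7.8: "`≺_{I_F}`
implies `≺`"); then pure dominance rigidity (`SoloInformedPureDominance`).

Consequence for the seat's map of the problem (SHARPEST.md, wall W4): modulo Varma's two
printed theorems exactly as the tree types them, local–global compatibility at `v ∤ ℓ` for the
Galois representations attached to regular algebraic cuspidal `π` is implied by the single
statement "`ι WD_v(ρ)` is pure of some weight" — with no genericity, temperedness or
normal-form hypothesis left over.

References: I. Varma, Forum Math. Sigma 12 (2024) e21, Thms. 1–2, Def. 8.3, Lemma 8.4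
[cite: VarmaFMS2024, Thms. 1–2]; J. Bellaïche, G. Chenevier, Astérisque 324 (2009), §7.8,
Def. 7.8.19, Prop. 7.8.1 [cite: BellaicheChenevier2009, §7.8]; R. Taylor, T. Yoshida, J. Amer.
Math. Soc. 20 (2007), Lemma 1.4 (4) [cite: TaylorYoshida2007, Lemma 1.4 (4)].
-/

noncomputable section

namespace Summit.Langlands.Langlands.Theorems

open scoped MatrixGroups Matrix Classical Polynomial NumberField
open NumberField IsDedekindDomain Field Polynomial Filter Module
open Literature.NumberTheory.Automorphic Literature.NumberTheory.GaloisRepresentations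
open Literature.NumberTheory.GaloisRepresentations.IsNonarchimedeanLocalField
open Literature.Barriers.Langlands (transport_ρ_apply transport_isEquivalent)

section WeilDeligne

-- Universe-monomorphic on purpose (`Type`, as in `SoloInformedPureDominance` and the summit
-- statement): the rigidity lemmas and `IsPure.isEquivalent` are stated over `Type`.
variable {L : Type} [Field L] [ValuativeRel L] [TopologicalSpace L] [IsNonarchimedeanLocalField L]
variable {V : Type} [AddCommGroup V] [Module ℂ V] {V' : Type} [AddCommGroup V'] [Module ℂ V']

/-- **Transport to a common Weil-group action.**  If `e : R.ρ ≅ S.ρ` intertwines the Weil-group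
actions of two Weil–Deligne representations, then `S` transported along `e⁻¹` has Weil-group
action literally `R.ρ`. [folklore] -/
theorem transport_symm_ρ_eq {R : WeilDeligneRep L ℂ V} {S : WeilDeligneRep L ℂ V'}
    (e : R.ρ.Equiv S.ρ) : (S.transport e.symm.toLinearEquiv).ρ = R.ρ := by
  refine MonoidHom.ext fun w => ?_
  rw [transport_ρ_apply]
  exact Representation.Equiv.conj_apply_self w e.symm

/-- **From Varma's shape to rank dominance over a common Weil-group action.**  Let `rss` be
Frobenius-semisimple, `S` Frobenius-semisimple with the same traces as `rss` and `rss ≺_I S`.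
Then there is a Frobenius-semisimple `W ≅ S` with `W.ρ = rss.ρ` and `rk rss.N^i ≤ rk W.N^i`
for all `i` (equal traces ⇒ `rss.ρ ≅ S.ρ`; transport; `≺_I` is a class invariant and implies
rank dominance). [new] (inputs: [cite: BellaicheChenevier2009, §7.8 Def. 7.8.19]) -/
theorem exists_frobSemisimple_repr_of_trace_eq_of_precI [FiniteDimensional ℂ V]
    [FiniteDimensional ℂ V'] {rss : WeilDeligneRep L ℂ V} (hrss : rss.IsFrobSemisimple)
    {S : WeilDeligneRep L ℂ V'} (hS : S.IsFrobSemisimple)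
    (htr : ∀ w : WeilGroup L, LinearMap.trace ℂ V (rss.ρ w) = LinearMap.trace ℂ V' (S.ρ w))
    (hprec : rss.PrecI S) :
    ∃ W : WeilDeligneRep L ℂ V, W.IsFrobSemisimple ∧ W.IsEquivalent S ∧ W.ρ = rss.ρ ∧
      ∀ i : ℕ, finrank ℂ ↥(LinearMap.range (rss.N ^ i)) ≤
        finrank ℂ ↥(LinearMap.range (W.N ^ i)) := by
  obtain ⟨e⟩ := WeilDeligneRep.nonempty_equiv_of_isFrobSemisimple_of_trace_eq hrss hS htr
  have hWρ : (S.transport e.symm.toLinearEquiv).ρ = rss.ρ := transport_symm_ρ_eq e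
  have hWS : (S.transport e.symm.toLinearEquiv).IsEquivalent S :=
    transport_isEquivalent S e.symm.toLinearEquiv
  have hWss : (S.transport e.symm.toLinearEquiv).IsFrobSemisimple := by
    intro w
    rw [hWρ]
    exact hrss w
  have hprec' : rss.PrecI (S.transport e.symm.toLinearEquiv) :=
    (WeilDeligneRep.IsEquivalent.precI_iff_right rss hWS).2 hprec
  exact ⟨S.transport e.symm.toLinearEquiv, hWss, hWS, hWρ, fun i => hprec'.finrank_range_pow_le i⟩

variable {n : ℕ}

/-- **Purity of `r` plus Varma's two conclusions pin the Frobenius-semisimple class of `r`.**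
If `r` is pure (of some weight, for some geometric Frobenius) and `S` is a Frobenius-semisimple
representation with the traces of `r` and with `r ≺_I S`, then `r^{F-ss}` has the class of `S`.
[new] (mechanism: [cite: TaylorYoshida2007, Lemma 1.4 (4)]) -/
theorem hasFrobSemisimpleClass_of_isPure_of_trace_eq_of_precI
    {r : WeilDeligneRep L ℂ (Fin n → ℂ)} {φ : WeilGroup L} (hφ : WeilGroup.deg φ = -1) {k : ℝ}
    (hpure : r.IsPure φ k) (S : WeilDeligneRep L ℂ (Fin n → ℂ)) (hS : S.IsFrobSemisimple)
    (htr : ∀ w : WeilGroup L,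
      LinearMap.trace ℂ (Fin n → ℂ) (r.ρ w) = LinearMap.trace ℂ (Fin n → ℂ) (S.ρ w))
    (hprec : r.PrecI S) :
    r.HasFrobSemisimpleClass (Quotient.mk (frobSemisimpleWDSetoid L n) ⟨S, hS⟩) := by
  obtain ⟨rss, hss⟩ := WeilDeligneRep.exists_isFrobSemisimplificationOf r
  have htr' : ∀ w : WeilGroup L,
      LinearMap.trace ℂ (Fin n → ℂ) (rss.ρ w) = LinearMap.trace ℂ (Fin n → ℂ) (S.ρ w) :=
    fun w => (hss.trace_eq w).trans (htr w)
  have hprec' : rss.PrecI S := (hss.precI_iff_left S).2 hprec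
  have hpure' : rss.IsPure φ k := (hss.isPure_iff φ k).mp hpure
  obtain ⟨W, -, hWS, hWρ, hdom⟩ :=
    exists_frobSemisimple_repr_of_trace_eq_of_precI hss.isFrobSemisimple hS htr' hprec'
  have h₁ : rss.IsEquivalent W :=
    isEquivalent_of_isPure_of_finrank_range_pow_le hφ hpure' hss.isFrobSemisimple hWρ hdom
  have h₂ : rss.IsEquivalent S := h₁.trans hWS
  exact ⟨rss, hss, Quotient.sound h₂⟩

end WeilDeligne

variable {n : ℕ} {K : Type} [Field K] [NumberField K] {hcpt : isCompact_glFiniteIntegralLevel n K}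
  {ℓ : ℕ} [Fact ℓ.Prime]

/-- **Door D4 in Varma's shape, typed against the summit statement.**  Let `π_v` be the local
component of `π` at `v`, `r = WD_v(ρ)` (the `ℓ`-adic Weil–Deligne representation, Grothendieck
at `v ∤ ℓ` / `D_pst` at `v ∣ ℓ` as in `LocalGlobalCompatibleAt`), `rℂ = ι(r)`, and `S` a
Frobenius-semisimple representative of `rec_v(π_v)`.  Assume the two conclusions of Varma's
Theorems 1–2 in the tree's typing (`Varma2024.theorem12_trace_eq_and_precI`, per place):
`tr rℂ.ρ(w) = tr S.ρ(w)` for all `w`, and `rℂ ≺_I S`.  If `rℂ` is pure of some real weight for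
some geometric Frobenius lift, then `LocalGlobalCompatibleAt 𝓡 ι π ρ v`.  No genericity of
`rec_v(π_v)`, no temperedness of `π_v`, and no same-space normal form is assumed. [new]
(inputs in print: [cite: VarmaFMS2024, Thms. 1–2]; mechanism: [cite: TaylorYoshida2007,
Lemma 1.4 (4)], [cite: BellaicheChenevier2009, §7.8]) -/
theorem localGlobalCompatibleAt_of_isPure_of_trace_eq_of_precI (𝓡 : ReciprocityData K)
    (ι : PadicAlgCl ℓ ≃+* ℂ) (π : AutomorphicRepData (AutomorphyDatum.gl n K hcpt))
    (ρ : FramedGaloisRep K (PadicAlgCl ℓ) n) (v : HeightOneSpectrum (𝓞 K))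
    (πv : SmoothIrrep (GL (Fin n) (v.adicCompletion K))) (hπv : π.HasLocalComponentAt v πv.ρ)
    (r : WeilDeligneRep (v.adicCompletion K) (PadicAlgCl ℓ) (Fin n → PadicAlgCl ℓ))
    (hr : ((ℓ : ℕ) : 𝓞 K) ∉ v.asIdeal → IsWeilDeligneOfLadic (ρ.toLocal v).toWeilGroupHom r)
    (hr' : ∀ hv : ((ℓ : ℕ) : 𝓞 K) ∈ v.asIdeal, (𝓡.pst ℓ v hv).IsWeilDeligneOf (ρ.toLocal v) r)
    (rℂ : WeilDeligneRep (v.adicCompletion K) ℂ (Fin n → ℂ))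
    (hι : r.IsTransportAlong (ι : PadicAlgCl ℓ →+* ℂ) rℂ)
    (S : WeilDeligneRep (v.adicCompletion K) ℂ (Fin n → ℂ)) (hS : S.IsFrobSemisimple)
    (hrec : Quotient.mk (frobSemisimpleWDSetoid (v.adicCompletion K) n) ⟨S, hS⟩ =
      (𝓡.llc v).recGL n (IrrClass.mk πv))
    (htr : ∀ w : WeilGroup (v.adicCompletion K),
      LinearMap.trace ℂ (Fin n → ℂ) (rℂ.ρ w) = LinearMap.trace ℂ (Fin n → ℂ) (S.ρ w))
    (hprec : rℂ.PrecI S)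
    {φ : WeilGroup (v.adicCompletion K)} (hφ : WeilGroup.deg φ = -1) {k : ℝ}
    (hpure : rℂ.IsPure φ k) :
    LocalGlobalCompatibleAt 𝓡 ι π ρ v :=
  ⟨πv, r, rℂ, hπv, hr, hr', hι,
    hrec ▸ hasFrobSemisimpleClass_of_isPure_of_trace_eq_of_precI hφ hpure S hS htr hprec⟩

end Summit.Langlands.Langlands.Theorems

end
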